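import Mathlib.Analysis.InnerProductSpace.Basic
import Mathlib.Analysis.InnerProductSpace.Subspace
import Mathlib.RingTheory.Polynomial.Basic
import Mathlib.Algebra.Polynomial.Roots
import Mathlib.FieldTheory.IsAlgClosed.Basic
import Mathlib.Analysis.Complex.Polynomial.Basic
import Mathlib.LinearAlgebra.Isomorphisms
import Literature.Analysis.OperatorTheory.NelsonSumOfSquares
import HarnessLib

/-!
# The energy bound for `Δ`-annihilated vectors of a skew-symmetric family

Let `H` be a complex inner product space (no completeness is assumed), `(A_i)_{i ∈ ι}` a finite
family of everywhere defined linear operators on `H` which are skew-symmetric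
(`⟪A_i u, w⟫ = -⟪u, A_i w⟫`), and `Δ = ∑_i A_i²` Nelson's Laplacian of the family (the tree's
`Literature.Analysis.OperatorTheory.laplacian`, `NelsonSumOfSquares`). Then `Δ` is symmetric and
`-⟪u, Δ u⟫ = ∑_i ‖A_i u‖² ≥ 0`. The main result of this file is the **uniform first-order energy
bound on the kernel of a polynomial in `Δ`**:

* `norm_apply_le_of_aeval_laplacian_eq_zero`: for every non-zero polynomial `q ∈ ℂ[X]`,
  `‖A_j u‖ ≤ C(q) ‖u‖` for every `j` and EVERY `u ∈ H` with `q(Δ) u = 0`, where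
  `C(q) = energyConstant q = ∑_{μ root of q} √|Re μ|`.

The point is uniformity in `u`: no finite-dimensional `Δ`-stable subspace containing `u` is needed
(contrast `exists_norm_laplacian_le` of `NelsonSumOfSquares`). Proof (elementary spectral theory of
a symmetric non-positive operator on its algebraic eigenvectors): `q = c ∏_μ (X - μ)^{m_μ}` over
the distinct complex roots, so `u = ∑_μ u_μ` with `(Δ - μ)^{m_μ} u_μ = 0` (coprime factors,
Mathlib `Polynomial.sup_ker_aeval_eq_ker_aeval_mul_of_coprime`); for a symmetric `S = Δ - μ`
(`μ` real) `ker S² = ker S`, while for `μ ∉ (-∞, 0]` the operator `Δ - μ` is injective because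
`⟪u, Δ u⟫ = μ ‖u‖²` forces `μ ∈ (-∞, 0]` when `u ≠ 0`; hence every `u_μ` is a genuine
eigenvector with real eigenvalue `μ ≤ 0` (or vanishes), the `u_μ` are pairwise orthogonal,
`‖u_μ‖ ≤ ‖u‖`, and `‖A_j u_μ‖² ≤ -⟪u_μ, Δ u_μ⟫ = |μ| ‖u_μ‖²`.

* `norm_map_apply_le_of_map_aeval_eq_zero` — the same bound in **pulled-back form**: for a
  complex vector space `W`, a linear map `T : W → H`, operators `L_i` on `W` that are skew for the
  pulled-back form (`⟪T (L_i x), T y⟫ = -⟪T x, T (L_i y)⟫`) and `Δ_W = ∑ L_i²`: if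
  `T (q(Δ_W) w) = 0` then `‖T (L_i w)‖ ≤ C(q) ‖T w‖` (passage to the quotient `W ⧸ ker T`, on
  which the `L_i` descend because `T (L_i x) = 0` whenever `T x = 0`, realised inside `H` as the
  range of `T`).

This is the operator-theoretic core of the smoothness of `K`-finite `Z(𝔤)`-finite vectors of
unitary representations (Harish-Chandra 1953, §9–10; Nelson 1959, via `Δ = Ω + 2Ω_K`): there `W` is
a space of test functions, `T` the Gårding map `α ↦ π(α) v`, `L_i` the left-invariant vector
fields, and `q(Δ)` annihilates `π(α) v` for all `Ad K`-invariant `α` by `K`- and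
`Z(𝔤)`-finiteness, uniformly along a Dirac sequence `α → δ`
(`Literature/NumberTheory/Automorphic`). Everything here is proved; the only definitions are the
constant `energyConstant q` and the induced operators `quotientOp` on `W ⧸ ker T`.

## References

* E. Nelson, *Analytic vectors*, Ann. of Math. 70 (1959), 572–615, §2 (the inequality
  `‖X ξ‖² ≤ (-Δ ξ, ξ)`) [Nelson1959].
* Harish-Chandra, *Representations of a semisimple Lie group on a Banach space. I*, Trans. AMS 75
  (1953), §9–10 [HarishChandraTAMS1953].
-/

open scoped InnerProductSpace
open Finset Polynomial

noncomputable section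

namespace Literature.Analysis.OperatorTheory

variable {H : Type*} [NormedAddCommGroup H] [InnerProductSpace ℂ H] {ι : Type*} [Fintype ι]

/-! ## Symmetry and non-positivity of the Laplacian -/

/-- For a skew-symmetric family the Laplacian `Δ = ∑ A_i²` is symmetric:
`⟪Δ u, w⟫ = ⟪u, Δ w⟫`. Nelson 1959, §2. [folklore] -/
theorem inner_laplacian_left_eq_right (A : ι → Module.End ℂ H)
    (hskew : ∀ i u w, ⟪A i u, w⟫_ℂ = -⟪u, A i w⟫_ℂ) (u w : H) :
    ⟪laplacian A u, w⟫_ℂ = ⟪u, laplacian A w⟫_ℂ := by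
  rw [laplacian_apply, laplacian_apply, sum_inner, inner_sum]
  refine Finset.sum_congr rfl fun i _ ↦ ?_
  rw [hskew, hskew, neg_neg]

/-- For a skew-symmetric family, `Re ⟪u, Δ u⟫ = -∑_i ‖A_i u‖²`. Nelson 1959, §2. [folklore] -/
theorem re_inner_laplacian_eq (A : ι → Module.End ℂ H)
    (hskew : ∀ i u w, ⟪A i u, w⟫_ℂ = -⟪u, A i w⟫_ℂ) (u : H) :
    (⟪u, laplacian A u⟫_ℂ).re = -∑ i, ‖A i u‖ ^ 2 := by
  rw [laplacian_apply, inner_sum, Complex.re_sum, ← Finset.sum_neg_distrib]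
  refine Finset.sum_congr rfl fun i _ ↦ ?_
  have h' : ⟪u, A i (A i u)⟫_ℂ = -⟪A i u, A i u⟫_ℂ := by rw [hskew, neg_neg]
  have hre : (⟪A i u, A i u⟫_ℂ).re = ‖A i u‖ ^ 2 := by
    simpa using inner_self_eq_norm_sq (𝕜 := ℂ) (A i u)
  rw [h', Complex.neg_re, hre]

/-- For a skew-symmetric family, `⟪u, Δ u⟫` is real. Nelson 1959, §2. [folklore] -/
theorem im_inner_laplacian_eq (A : ι → Module.End ℂ H)
    (hskew : ∀ i u w, ⟪A i u, w⟫_ℂ = -⟪u, A i w⟫_ℂ) (u : H) :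
    (⟪u, laplacian A u⟫_ℂ).im = 0 := by
  rw [laplacian_apply, inner_sum, Complex.im_sum]
  refine Finset.sum_eq_zero fun i _ ↦ ?_
  have h' : ⟪u, A i (A i u)⟫_ℂ = -⟪A i u, A i u⟫_ℂ := by rw [hskew, neg_neg]
  have him : (⟪A i u, A i u⟫_ℂ).im = 0 := by
    simpa using inner_self_im (𝕜 := ℂ) (A i u)
  rw [h', Complex.neg_im, him, neg_zero]

/-- If `Δ u = μ u` with `u ≠ 0`, then `μ` is a non-positive real number: `⟪u, Δ u⟫ = μ ‖u‖²` is
real and `≤ 0`. Nelson 1959, §2. [folklore] -/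
theorem im_eq_zero_and_re_nonpos_of_laplacian_eq_smul (A : ι → Module.End ℂ H)
    (hskew : ∀ i u w, ⟪A i u, w⟫_ℂ = -⟪u, A i w⟫_ℂ) {μ : ℂ} {u : H} (hu : u ≠ 0)
    (h : laplacian A u = μ • u) : μ.im = 0 ∧ μ.re ≤ 0 := by
  have hz_re : (⟪u, u⟫_ℂ).re = ‖u‖ ^ 2 := by simpa using inner_self_eq_norm_sq (𝕜 := ℂ) u
  have hz_im : (⟪u, u⟫_ℂ).im = 0 := by simpa using inner_self_im (𝕜 := ℂ) u
  have key : ⟪u, laplacian A u⟫_ℂ = μ * ⟪u, u⟫_ℂ := by rw [h, inner_smul_right]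
  have hnorm : (0 : ℝ) < ‖u‖ ^ 2 := by positivity
  have hsum : (0 : ℝ) ≤ ∑ i, ‖A i u‖ ^ 2 := Finset.sum_nonneg fun i _ ↦ sq_nonneg _
  have him : μ.im * ‖u‖ ^ 2 = 0 := by
    have := im_inner_laplacian_eq A hskew u
    rwa [key, Complex.mul_im, hz_re, hz_im, mul_zero, zero_add] at this
  have hre : μ.re * ‖u‖ ^ 2 = -∑ i, ‖A i u‖ ^ 2 := by
    have := re_inner_laplacian_eq A hskew u
    rwa [key, Complex.mul_re, hz_re, hz_im, mul_zero, sub_zero] at this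
  refine ⟨?_, ?_⟩
  · rcases mul_eq_zero.mp him with h1 | h1
    · exact h1
    · exact absurd h1 hnorm.ne'
  · by_contra hpos
    have := mul_pos (not_le.mp hpos) hnorm
    linarith

/-- Hence `Δ - μ` is injective unless `μ` is a non-positive real number. [folklore] -/
theorem eq_zero_of_laplacian_sub_smul_eq_zero (A : ι → Module.End ℂ H)
    (hskew : ∀ i u w, ⟪A i u, w⟫_ℂ = -⟪u, A i w⟫_ℂ) {μ : ℂ} (hμ : ¬ (μ.im = 0 ∧ μ.re ≤ 0))
    {u : H} (h : laplacian A u - μ • u = 0) : u = 0 := by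
  by_contra hu
  exact hμ (im_eq_zero_and_re_nonpos_of_laplacian_eq_smul A hskew hu (sub_eq_zero.mp h))

/-! ## Kernels of powers of `Δ - μ` -/

/-- The operator `Δ - μ` as an endomorphism (the value of the polynomial `X - μ` at `Δ`).
[folklore] -/
theorem aeval_X_sub_C_apply (A : ι → Module.End ℂ H) (μ : ℂ) (u : H) :
    aeval (laplacian A) (X - C μ) u = laplacian A u - μ • u := by
  simp [Algebra.algebraMap_eq_smul_one]

omit [Fintype ι] in
/-- A symmetric operator `S` has `ker S² = ker S`: if `S (S u) = 0` then
`‖S u‖² = ⟪S (S u), u⟫ = 0`. [folklore] -/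
theorem apply_eq_zero_of_symmetric_of_sq_eq_zero (S : Module.End ℂ H)
    (hS : ∀ u w, ⟪S u, w⟫_ℂ = ⟪u, S w⟫_ℂ) {u : H} (h : S (S u) = 0) : S u = 0 := by
  have : ⟪S u, S u⟫_ℂ = 0 := by rw [← hS, h, inner_zero_left]
  exact inner_self_eq_zero.mp this

omit [Fintype ι] in
/-- A symmetric operator `S` has `ker S^m = ker S` for `m ≥ 1`. [folklore] -/
theorem apply_eq_zero_of_symmetric_of_pow_eq_zero (S : Module.End ℂ H)
    (hS : ∀ u w, ⟪S u, w⟫_ℂ = ⟪u, S w⟫_ℂ) {m : ℕ} (hm : m ≠ 0) {u : H} (h : (S ^ m) u = 0) :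
    S u = 0 := by
  induction m generalizing u with
  | zero => exact absurd rfl hm
  | succ m ih =>
    rcases Nat.eq_zero_or_pos m with rfl | hpos
    · simpa using h
    · -- `S^{m+1} u = S^m (S u) = 0`, so `S (S u) = 0` by induction, whence `S u = 0`
      have h' : (S ^ m) (S u) = 0 := by
        rw [pow_succ] at h
        exact h
      exact apply_eq_zero_of_symmetric_of_sq_eq_zero S hS (ih hpos.ne' h')

/-- For real `μ`, the operator `Δ - μ` is symmetric. [folklore] -/
theorem inner_laplacian_sub_smul_symmetric (A : ι → Module.End ℂ H)
    (hskew : ∀ i u w, ⟪A i u, w⟫_ℂ = -⟪u, A i w⟫_ℂ) {μ : ℂ} (hμ : μ.im = 0) (u w : H) :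
    ⟪aeval (laplacian A) (X - C μ) u, w⟫_ℂ = ⟪u, aeval (laplacian A) (X - C μ) w⟫_ℂ := by
  rw [aeval_X_sub_C_apply, aeval_X_sub_C_apply, inner_sub_left, inner_sub_right,
    inner_smul_left, inner_smul_right, inner_laplacian_left_eq_right A hskew]
  have hconj : (starRingEnd ℂ) μ = μ := Complex.conj_eq_iff_im.mpr hμ
  rw [hconj]

/-- **Generalized eigenvectors of `Δ` are eigenvectors with non-positive real eigenvalue (or
zero).** If `(Δ - μ)^m u = 0` then `Δ u = μ u`, and `u = 0` unless `μ ∈ (-∞, 0]`. [folklore] -/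
theorem laplacian_eq_smul_of_aeval_pow_eq_zero (A : ι → Module.End ℂ H)
    (hskew : ∀ i u w, ⟪A i u, w⟫_ℂ = -⟪u, A i w⟫_ℂ) (μ : ℂ) (m : ℕ) {u : H}
    (h : aeval (laplacian A) ((X - C μ) ^ m) u = 0) :
    laplacian A u = μ • u ∧ (u = 0 ∨ (μ.im = 0 ∧ μ.re ≤ 0)) := by
  by_cases hμ : μ.im = 0 ∧ μ.re ≤ 0
  · -- symmetric case: `ker (Δ - μ)^m = ker (Δ - μ)`
    refine ⟨?_, Or.inr hμ⟩
    rcases Nat.eq_zero_or_pos m with rfl | hpos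
    · have hu : u = 0 := by simpa using h
      simp [hu]
    · have h' : ((aeval (laplacian A) (X - C μ)) ^ m) u = 0 := by rwa [← map_pow]
      have h0 := apply_eq_zero_of_symmetric_of_pow_eq_zero (aeval (laplacian A) (X - C μ))
        (inner_laplacian_sub_smul_symmetric A hskew hμ.1) hpos.ne' h'
      rw [aeval_X_sub_C_apply] at h0
      exact sub_eq_zero.mp h0
  · -- injective case: `(Δ - μ)^m` is injective, so `u = 0`
    have hu : u = 0 := by
      induction m generalizing u with
      | zero => simpa using h
      | succ m ih =>
        have h' : aeval (laplacian A) ((X - C μ) ^ m) (aeval (laplacian A) (X - C μ) u) = 0 := by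
          rw [← Module.End.mul_apply, ← map_mul, ← pow_succ]
          exact h
        have h1 := ih h'
        rw [aeval_X_sub_C_apply] at h1
        exact eq_zero_of_laplacian_sub_smul_eq_zero A hskew hμ h1
    exact ⟨by simp [hu], Or.inl hu⟩

/-! ## The decomposition along the roots of `q` -/

omit [Fintype ι] in
/-- **Kernel decomposition along distinct linear factors.** If `∏_{μ ∈ S} (Δ - μ)^{m_μ} u = 0`
then `u = ∑_{μ ∈ S} u_μ` with `(Δ - μ)^{m_μ} u_μ = 0` (the factors are pairwise coprime; Mathlib
`Polynomial.sup_ker_aeval_eq_ker_aeval_mul_of_coprime`). [folklore] -/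
theorem exists_sum_eq_of_aeval_prod_eq_zero (Δ : Module.End ℂ H) (m : ℂ → ℕ) (S : Finset ℂ)
    {u : H} (h : aeval Δ (∏ μ ∈ S, (X - C μ) ^ m μ) u = 0) :
    ∃ v : ℂ → H, (∀ μ ∈ S, aeval Δ ((X - C μ) ^ m μ) (v μ) = 0) ∧ u = ∑ μ ∈ S, v μ := by
  classical
  induction S using Finset.induction_on generalizing u with
  | empty =>
    refine ⟨fun _ ↦ 0, fun _ h ↦ absurd h (Finset.notMem_empty _), ?_⟩
    simpa using h
  | insert a S ha ih =>
    rw [Finset.prod_insert ha] at h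
    -- the two factors are coprime
    have hcop : IsCoprime ((X - C a) ^ m a) (∏ μ ∈ S, (X - C μ) ^ m μ) := by
      refine IsCoprime.prod_right fun μ hμ ↦ IsCoprime.pow ?_
      have hne : a ≠ μ := fun e ↦ ha (e ▸ hμ)
      exact pairwise_coprime_X_sub_C (K := ℂ) Function.injective_id hne
    have hmem : u ∈ LinearMap.ker (aeval Δ ((X - C a) ^ m a * ∏ μ ∈ S, (X - C μ) ^ m μ)) := h
    rw [← sup_ker_aeval_eq_ker_aeval_mul_of_coprime Δ hcop, Submodule.mem_sup] at hmem
    obtain ⟨y, hy, z, hz, hyz⟩ := hmem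
    obtain ⟨v, hv, hzsum⟩ := ih (u := z) hz
    refine ⟨Function.update v a y, fun μ hμ ↦ ?_, ?_⟩
    · rcases Finset.mem_insert.mp hμ with rfl | hμS
      · rw [Function.update_self]; exact hy
      · have hne : μ ≠ a := fun e ↦ ha (e ▸ hμS)
        rw [Function.update_of_ne hne]; exact hv μ hμS
    · rw [Finset.sum_insert ha, Function.update_self, ← hyz, hzsum]
      congr 1
      refine Finset.sum_congr rfl fun μ hμS ↦ ?_
      have hne : μ ≠ a := fun e ↦ ha (e ▸ hμS)
      rw [Function.update_of_ne hne]

/-- A complex polynomial is its leading coefficient times the product of `(X - μ)^{m_μ}` over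
its distinct roots (`ℂ` is algebraically closed). [folklore] -/
theorem eq_C_mul_prod_pow (q : ℂ[X]) :
    q = C q.leadingCoeff * ∏ μ ∈ q.roots.toFinset, (X - C μ) ^ q.roots.count μ := by
  classical
  have hcard : q.roots.card = q.natDegree := splits_iff_card_roots.mp (IsAlgClosed.splits q)
  have h := C_leadingCoeff_mul_prod_multiset_X_sub_C hcard
  rw [Finset.prod_multiset_map_count] at h
  exact h.symm

omit [Fintype ι] in
/-- If `q(Δ) u = 0` for a non-zero `q`, then `u` decomposes along the distinct roots of `q`.
[folklore] -/
theorem exists_sum_eq_of_aeval_eq_zero (Δ : Module.End ℂ H) {q : ℂ[X]} (hq : q ≠ 0) {u : H}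
    (h : aeval Δ q u = 0) :
    ∃ v : ℂ → H, (∀ μ ∈ q.roots.toFinset, aeval Δ ((X - C μ) ^ q.roots.count μ) (v μ) = 0) ∧
      u = ∑ μ ∈ q.roots.toFinset, v μ := by
  classical
  refine exists_sum_eq_of_aeval_prod_eq_zero Δ (fun μ ↦ q.roots.count μ) q.roots.toFinset ?_
  have hlc : q.leadingCoeff ≠ 0 := leadingCoeff_ne_zero.mpr hq
  rw [eq_C_mul_prod_pow q, map_mul, aeval_C, Module.End.mul_apply,
    Module.algebraMap_end_apply, smul_eq_zero] at h
  exact h.resolve_left hlc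

/-! ## Orthogonality and the energy bound -/

/-- Eigenvectors of the symmetric operator `Δ` for distinct eigenvalues are orthogonal.
[folklore] -/
theorem inner_eq_zero_of_laplacian_eq_smul (A : ι → Module.End ℂ H)
    (hskew : ∀ i u w, ⟪A i u, w⟫_ℂ = -⟪u, A i w⟫_ℂ) {μ μ' : ℂ} (hne : μ ≠ μ') {u u' : H}
    (hu : laplacian A u = μ • u) (hu' : laplacian A u' = μ' • u') : ⟪u, u'⟫_ℂ = 0 := by
  by_contra hinner
  have hu0 : u ≠ 0 := fun e ↦ hinner (by rw [e, inner_zero_left])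
  have hreal := (im_eq_zero_and_re_nonpos_of_laplacian_eq_smul A hskew hu0 hu).1
  have key : (starRingEnd ℂ) μ * ⟪u, u'⟫_ℂ = μ' * ⟪u, u'⟫_ℂ := by
    rw [← inner_smul_left, ← inner_smul_right, ← hu, ← hu',
      inner_laplacian_left_eq_right A hskew]
  rw [Complex.conj_eq_iff_im.mpr hreal] at key
  have : (μ - μ') * ⟪u, u'⟫_ℂ = 0 := by rw [sub_mul, key, sub_self]
  rcases mul_eq_zero.mp this with h1 | h1
  · exact hne (sub_eq_zero.mp h1)
  · exact hinner h1

omit [Fintype ι] in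
/-- Pythagoras for a finite pairwise orthogonal family: `‖∑ v_μ‖² = ∑ ‖v_μ‖²`. [folklore] -/
theorem norm_sum_sq_eq_of_pairwise_inner_eq_zero (S : Finset ℂ) (v : ℂ → H)
    (horth : ∀ μ ∈ S, ∀ μ' ∈ S, μ ≠ μ' → ⟪v μ, v μ'⟫_ℂ = 0) :
    ‖∑ μ ∈ S, v μ‖ ^ 2 = ∑ μ ∈ S, ‖v μ‖ ^ 2 := by
  have h0 : (⟪∑ μ ∈ S, v μ, ∑ μ ∈ S, v μ⟫_ℂ).re = ‖∑ μ ∈ S, v μ‖ ^ 2 := by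
    simpa using inner_self_eq_norm_sq (𝕜 := ℂ) (∑ μ ∈ S, v μ)
  rw [← h0, sum_inner, Complex.re_sum]
  refine Finset.sum_congr rfl fun μ hμ ↦ ?_
  rw [inner_sum, Finset.sum_eq_single μ]
  · simpa using inner_self_eq_norm_sq (𝕜 := ℂ) (v μ)
  · intro μ' hμ' hne
    exact horth μ hμ μ' hμ' (Ne.symm hne)
  · intro hμn
    exact absurd hμ hμn

/-- The constant of the energy bound: `C(q) = ∑_{μ root of q} √|Re μ|` (sum over the distinct
complex roots). [folklore] -/
def energyConstant (q : ℂ[X]) : ℝ :=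
  ∑ μ ∈ q.roots.toFinset, Real.sqrt |μ.re|

/-- `C(q) ≥ 0`. [folklore] -/
theorem energyConstant_nonneg (q : ℂ[X]) : 0 ≤ energyConstant q :=
  Finset.sum_nonneg fun _ _ ↦ Real.sqrt_nonneg _

/-- The energy bound on a single eigenvector: if `Δ u = μ u` then `‖A_j u‖ ≤ √|Re μ| ‖u‖`
(`‖A_j u‖² ≤ -⟪u, Δ u⟫ = -Re μ ‖u‖²`). Nelson 1959, §2. [folklore] -/
theorem norm_apply_le_of_laplacian_eq_smul (A : ι → Module.End ℂ H)
    (hskew : ∀ i u w, ⟪A i u, w⟫_ℂ = -⟪u, A i w⟫_ℂ) {μ : ℂ} {u : H}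
    (hu : laplacian A u = μ • u) (j : ι) : ‖A j u‖ ≤ Real.sqrt |μ.re| * ‖u‖ := by
  have h1 := norm_apply_sq_le_neg_re_inner_laplacian A hskew j u
  have key : ⟪u, laplacian A u⟫_ℂ = μ * ⟪u, u⟫_ℂ := by rw [hu, inner_smul_right]
  have hz_re : (⟪u, u⟫_ℂ).re = ‖u‖ ^ 2 := by simpa using inner_self_eq_norm_sq (𝕜 := ℂ) u
  have hz_im : (⟪u, u⟫_ℂ).im = 0 := by simpa using inner_self_im (𝕜 := ℂ) u
  have h2 : RCLike.re ⟪u, laplacian A u⟫_ℂ = μ.re * ‖u‖ ^ 2 := by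
    rw [RCLike.re_to_complex, key, Complex.mul_re, hz_re, hz_im, mul_zero, sub_zero]
  rw [h2] at h1
  have h3 : ‖A j u‖ ^ 2 ≤ (Real.sqrt |μ.re| * ‖u‖) ^ 2 := by
    rw [mul_pow, Real.sq_sqrt (abs_nonneg _)]
    refine h1.trans ?_
    rw [← neg_mul]
    exact mul_le_mul_of_nonneg_right (neg_le_abs _) (sq_nonneg _)
  exact (abs_le_of_sq_le_sq' h3 (by positivity)).2

/-- **The uniform energy bound on `ker q(Δ)`.** For a skew-symmetric family `(A_i)` with
Laplacian `Δ = ∑ A_i²` and a non-zero `q ∈ ℂ[X]`: `‖A_j u‖ ≤ C(q) ‖u‖` for all `j` and all `u`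
with `q(Δ) u = 0`, where `C(q) = ∑_{μ} √|Re μ|` over the distinct roots of `q`. Nelson 1959, §2
(the inequality `‖X ξ‖² ≤ (-Δ ξ, ξ)`), combined with the orthogonal decomposition of `u` into
eigenvectors of the symmetric operator `Δ`. [folklore] -/
theorem norm_apply_le_of_aeval_laplacian_eq_zero (A : ι → Module.End ℂ H)
    (hskew : ∀ i u w, ⟪A i u, w⟫_ℂ = -⟪u, A i w⟫_ℂ) {q : ℂ[X]} (hq : q ≠ 0) {u : H}
    (h : aeval (laplacian A) q u = 0) (j : ι) : ‖A j u‖ ≤ energyConstant q * ‖u‖ := by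
  classical
  obtain ⟨v, hv, hsum⟩ := exists_sum_eq_of_aeval_eq_zero (laplacian A) hq h
  set S := q.roots.toFinset with hS
  -- each component is an eigenvector with admissible eigenvalue, or zero
  have hev : ∀ μ ∈ S, laplacian A (v μ) = μ • v μ ∧ (v μ = 0 ∨ (μ.im = 0 ∧ μ.re ≤ 0)) :=
    fun μ hμ ↦ laplacian_eq_smul_of_aeval_pow_eq_zero A hskew μ _ (hv μ hμ)
  -- pairwise orthogonality
  have horth : ∀ μ ∈ S, ∀ μ' ∈ S, μ ≠ μ' → ⟪v μ, v μ'⟫_ℂ = 0 := fun μ hμ μ' hμ' hne ↦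
    inner_eq_zero_of_laplacian_eq_smul A hskew hne (hev μ hμ).1 (hev μ' hμ').1
  -- `‖v μ‖ ≤ ‖u‖`
  have hcomp : ∀ μ ∈ S, ‖v μ‖ ≤ ‖u‖ := by
    intro μ hμ
    have hpy := norm_sum_sq_eq_of_pairwise_inner_eq_zero S v horth
    rw [← hsum] at hpy
    have : ‖v μ‖ ^ 2 ≤ ‖u‖ ^ 2 := by
      rw [hpy]
      exact Finset.single_le_sum (f := fun μ ↦ ‖v μ‖ ^ 2) (fun _ _ ↦ sq_nonneg _) hμ
    exact (abs_le_of_sq_le_sq' this (norm_nonneg _)).2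
  -- sum up
  calc ‖A j u‖ = ‖∑ μ ∈ S, A j (v μ)‖ := by rw [hsum, map_sum]
    _ ≤ ∑ μ ∈ S, ‖A j (v μ)‖ := norm_sum_le _ _
    _ ≤ ∑ μ ∈ S, Real.sqrt |μ.re| * ‖u‖ := by
        refine Finset.sum_le_sum fun μ hμ ↦ ?_
        refine (norm_apply_le_of_laplacian_eq_smul A hskew (hev μ hμ).1 j).trans ?_
        exact mul_le_mul_of_nonneg_left (hcomp μ hμ) (Real.sqrt_nonneg _)
    _ = energyConstant q * ‖u‖ := by rw [energyConstant, Finset.sum_mul]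

/-- **The uniform energy bound, existential form**: there is `C ≥ 0`, depending only on the
non-zero polynomial `q`, with `‖A_j u‖ ≤ C ‖u‖` for every skew-symmetric family `A` on every
complex inner product space `H`, all `j` and all `u ∈ ker q(Δ_A)`. Nelson 1959, §2. [folklore] -/
theorem exists_norm_apply_le_of_aeval_laplacian_eq_zero (q : ℂ[X]) (hq : q ≠ 0) :
    ∃ C : ℝ, 0 ≤ C ∧ ∀ (A : ι → Module.End ℂ H), (∀ i u w, ⟪A i u, w⟫_ℂ = -⟪u, A i w⟫_ℂ) →
      ∀ u : H, aeval (laplacian A) q u = 0 → ∀ j, ‖A j u‖ ≤ C * ‖u‖ :=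
  ⟨energyConstant q, energyConstant_nonneg q, fun A hskew _ h j ↦
    norm_apply_le_of_aeval_laplacian_eq_zero A hskew hq h j⟩

/-! ## Pulled-back form: a degenerate pairing through a linear map `T : W → H` -/

section Pullback

variable {W : Type*} [AddCommGroup W] [Module ℂ W]

omit [Fintype ι] in
/-- If the operators `L_i` on `W` are skew for the form pulled back along `T : W → H`, then
`ker T` is stable under each `L_i`: `T x = 0` implies `T (L_i x) = 0`
(`‖T (L_i x)‖² = -⟪T x, T (L_i (L_i x))⟫ = 0`). [folklore] -/
theorem map_apply_eq_zero_of_map_eq_zero (T : W →ₗ[ℂ] H) (L : ι → Module.End ℂ W)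
    (hskew : ∀ i x y, ⟪T (L i x), T y⟫_ℂ = -⟪T x, T (L i y)⟫_ℂ) (i : ι) {x : W} (hx : T x = 0) :
    T (L i x) = 0 := by
  have : ⟪T (L i x), T (L i x)⟫_ℂ = 0 := by rw [hskew, hx, inner_zero_left, neg_zero]
  exact inner_self_eq_zero.mp this

omit [Fintype ι] in
/-- The operator induced by `L_i` on the quotient `W ⧸ ker T`. [folklore] -/
def quotientOp (T : W →ₗ[ℂ] H) (L : ι → Module.End ℂ W)
    (hskew : ∀ i x y, ⟪T (L i x), T y⟫_ℂ = -⟪T x, T (L i y)⟫_ℂ) (i : ι) :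
    Module.End ℂ (W ⧸ LinearMap.ker T) :=
  (LinearMap.ker T).mapQ (LinearMap.ker T) (L i) fun x hx ↦ by
    rw [Submodule.mem_comap, LinearMap.mem_ker]
    exact map_apply_eq_zero_of_map_eq_zero T L hskew i hx

omit [Fintype ι] in
/-- `L̄_i [x] = [L_i x]`. [folklore] -/
theorem quotientOp_mk (T : W →ₗ[ℂ] H) (L : ι → Module.End ℂ W)
    (hskew : ∀ i x y, ⟪T (L i x), T y⟫_ℂ = -⟪T x, T (L i y)⟫_ℂ) (i : ι) (x : W) :
    quotientOp T L hskew i (Submodule.Quotient.mk x) = Submodule.Quotient.mk (L i x) :=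
  rfl

/-- **The energy bound in pulled-back form.** Let `T : W → H` be linear, `(L_i)` operators on `W`
skew for the pulled-back form, `Δ_W = ∑ L_i²`, and `q ≠ 0`. If `T (q(Δ_W) w) = 0` then
`‖T (L_i w)‖ ≤ C(q) ‖T w‖` for every `i`. (Apply the bound on `W ⧸ ker T`, an inner product space
through the injective `T̄`, realised inside `H` as the range of `T`.) Nelson 1959, §2. [folklore] -/
theorem norm_map_apply_le_of_map_aeval_eq_zero (T : W →ₗ[ℂ] H) (L : ι → Module.End ℂ W)
    (hskew : ∀ i x y, ⟪T (L i x), T y⟫_ℂ = -⟪T x, T (L i y)⟫_ℂ) {q : ℂ[X]} (hq : q ≠ 0)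
    {w : W} (h : T (aeval (∑ i, L i * L i) q w) = 0) (i : ι) :
    ‖T (L i w)‖ ≤ energyConstant q * ‖T w‖ := by
  -- work in the subspace `V = range T` of `H` with the operators transported from `W ⧸ ker T`
  let V : Submodule ℂ H := LinearMap.range T
  let e : (W ⧸ LinearMap.ker T) ≃ₗ[ℂ] V := LinearMap.quotKerEquivRange T
  let A : ι → Module.End ℂ V := fun i ↦
    (e : (W ⧸ LinearMap.ker T) →ₗ[ℂ] V) ∘ₗ quotientOp T L hskew i ∘ₗ
      (e.symm : V →ₗ[ℂ] (W ⧸ LinearMap.ker T))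
  have he : ∀ x : W, (e (Submodule.Quotient.mk x) : H) = T x := fun x ↦
    LinearMap.quotKerEquivRange_apply_mk T x
  -- every element of `V` is `e [x]`
  have hsurj : ∀ y : V, ∃ x : W, e (Submodule.Quotient.mk x) = y := by
    intro y
    obtain ⟨z, hz⟩ := e.surjective y
    obtain ⟨x, rfl⟩ := Submodule.Quotient.mk_surjective _ z
    exact ⟨x, hz⟩
  have hA : ∀ i (x : W), A i (e (Submodule.Quotient.mk x)) = e (Submodule.Quotient.mk (L i x)) := by
    intro i x
    simp only [A, LinearMap.coe_comp, LinearEquiv.coe_coe, Function.comp_apply,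
      LinearEquiv.symm_apply_apply, quotientOp_mk]
  -- skew-symmetry of the transported family
  have hskewA : ∀ i (u w : V), ⟪A i u, w⟫_ℂ = -⟪u, A i w⟫_ℂ := by
    intro i u w
    obtain ⟨x, rfl⟩ := hsurj u
    obtain ⟨y, rfl⟩ := hsurj w
    rw [hA, hA, Submodule.coe_inner, Submodule.coe_inner, he, he, he, he]
    exact hskew i x y
  -- the classes of the sums `Δ_W y`
  have hΔ : ∀ x : W, (∑ i, A i (A i (e (Submodule.Quotient.mk x)))) =
      e (Submodule.Quotient.mk ((∑ i, L i * L i) x)) := by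
    intro x
    simp only [hA]
    rw [← map_sum]
    congr 1
    change ∑ i, (LinearMap.ker T).mkQ (L i (L i x)) = (LinearMap.ker T).mkQ ((∑ i, L i * L i) x)
    rw [LinearMap.sum_apply, map_sum]
    rfl
  -- the quotient map intertwines the powers of the Laplacians
  have hpowA : ∀ (k : ℕ) (x : W), ((laplacian A) ^ k) (e (Submodule.Quotient.mk x)) =
      e (Submodule.Quotient.mk (((∑ i, L i * L i) ^ k) x)) := by
    intro k
    induction k with
    | zero => intro x; simp
    | succ k ih =>
      intro x
      rw [pow_succ, Module.End.mul_apply, laplacian_apply, hΔ, ih, ← Module.End.mul_apply,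
        ← pow_succ]
  have haevalA : ∀ (p : ℂ[X]) (x : W), aeval (laplacian A) p (e (Submodule.Quotient.mk x)) =
      e (Submodule.Quotient.mk (aeval (∑ i, L i * L i) p x)) := by
    intro p x
    induction p using Polynomial.induction_on' with
    | add p q hp hq => simp only [map_add, LinearMap.add_apply, hp, hq, Submodule.Quotient.mk_add]
    | monomial k c =>
      simp only [aeval_monomial, Module.End.mul_apply, hpowA, Module.algebraMap_end_apply,
        Submodule.Quotient.mk_smul, map_smul]
  -- the vector `u = [w]` is killed by `q(Δ_A)`
  have hu : aeval (laplacian A) q (e (Submodule.Quotient.mk w)) = 0 := by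
    rw [haevalA]
    have : (e (Submodule.Quotient.mk (aeval (∑ i, L i * L i) q w)) : H) = 0 := by rw [he]; exact h
    exact (Submodule.coe_eq_zero).mp this
  have hmain := norm_apply_le_of_aeval_laplacian_eq_zero A hskewA hq hu i
  rw [hA] at hmain
  have h1 : ‖(e (Submodule.Quotient.mk (L i w)) : V)‖ = ‖T (L i w)‖ := by
    rw [← he, Submodule.coe_norm]
  have h2 : ‖(e (Submodule.Quotient.mk w) : V)‖ = ‖T w‖ := by
    rw [← he, Submodule.coe_norm]
  rwa [h1, h2] at hmain

end Pullback

end Literature.Analysis.OperatorTheory
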